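import Mathlib
import Summits.Ventures.HodgeRepro2.T5ProfiniteDistributionPadic
import Summits.Ventures.HodgeRepro2.T5PushforwardMeasure
import Summits.Ventures.HodgeRepro2.T5PropGBranchModel

/-!
# T5ProfiniteDistributionPushforward — the push-forward of a measure along a map of presented
profinite spaces, on the coordinates: the printed map `W[[Γ⁻]] → W[[Γ_𝔭]]`, `[a] ↦ [π(a)]` at
every level; the branch measures of `ModelData` in these coordinates

Tier-5 support for route-3's §G (route/T5-CHECK-G-p7.md §3 S1, §19.2 «stays prose of S1 / S4:
… the push-forward identity Q17 that pushes to Γ_𝔭», §20.5): in print the branch measure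
`L⁻_{Σ,λ⁻¹,𝔭} ∈ W[[Γ_𝔭]]` is the image of `L⁻_{Σ,λ⁻¹} ∈ W[[Γ⁻]]` under the ring map
`W[[Γ⁻]] → W[[Γ_𝔭]]` induced by the projection `Γ⁻ → Γ_𝔭`, i.e. level by level by
`W[Γ⁻/p^kΓ⁻] → W[Γ_𝔭/p^kΓ_𝔭]`, `Σ_a v_a [a] ↦ Σ_b (Σ_{π(a) = b} v_a) [b]`; in the model it is
T5PushforwardMeasure's `pushforward π m : ψ ↦ m(ψ ∘ π)`.  The two agree:

* `Hom P Q π` — a morphism of presentations over a continuous `π : X → Y`: level maps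
  `level k : F_X k → F_Y k` with `q_Y k (π x) = level k (q_X k x)`;
* **`coord_pushforward`** — `coord (pushforward π m) k b = Σ_{a : level k a = b} coord m k a`:
  the coordinates of the push-forward are the fibre sums of the coordinates (the indicator of a
  fibre of `Y` pulled back along `π` is the sum of the indicators of the fibres of `X` over it);
* the instances `ℤ_p^ι → ℤ_p`: the coordinate projection `projHom i₀` and every `ℤ_p-linear
  combination `linearHom c : x ↦ Σ_i c_i x_i` (level maps the reductions mod `p^k` of the same
  formula) — the projection `Γ⁻ ≅ ℤ_p^δ → Γ_𝔭 ≅ ℤ_p` of S1 in both readings — with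
  **`coord_pushforward_linear`** as the printed formula;
* T5PropGBranchModel's `ModelData` on `Γ⁻ = ℤ_p^ι` with `π` a linear combination of the
  coordinates, in these coordinates: **`coord_Mlam`** (`coord (ν̃·M) k a = M(ν̃ · 1_{a + p^kΓ⁻})`),
  **`coord_Mp_of_linear`** (`coord (L⁻_{Σ,λ⁻¹,𝔭}) k b = Σ_{Σ_i c_i a_i ≡ b} coord (L⁻_{Σ,λ⁻¹}) k a` —
  the 𝔭-line measure as the level-wise image of the twisted Hsieh measure), `coord_M_eq_of_coord_eq`,
  `Mp_eq_of_coord_eq` (`Mp` is determined by `ν̃`, `π` and the coordinates of `M`).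

No printed input is consumed.  §8(d): uses an L-value-free non-vanishing device: NO.
-/

namespace Summit.Ventures.HodgeRepro2.T5ProfiniteDistributionPushforward

open Summit.Ventures.HodgeRepro2.T5MeasureSupOnClopens (indicatorCM indicatorCM_apply)
open Summit.Ventures.HodgeRepro2.T5ProfiniteDistribution
open Summit.Ventures.HodgeRepro2.T5ProfiniteDistributionPadic
open Summit.Ventures.HodgeRepro2.T5PushforwardMeasure (pushforward pushforward_apply)
open Finset

universe u v u' v'

/-- A MORPHISM of presentations over a continuous map `π : X → Y`: level maps
`level k : F_X k → F_Y k` compatible with the level maps of `X` and `Y`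
(`Γ⁻/p^kΓ⁻ → Γ_𝔭/p^kΓ_𝔭` induced by `Γ⁻ → Γ_𝔭`). -/
structure Hom {X : Type u} {Y : Type u'} [MetricSpace X] [MetricSpace Y]
    (P : Presentation.{u, v} X) (Q : Presentation.{u', v'} Y) (π : C(X, Y)) where
  /-- the map at level `k`. -/
  level : ∀ k, P.F k → Q.F k
  /-- compatibility with the level maps. -/
  level_q : ∀ (k : ℕ) (x : X), Q.q k (π x) = level k (P.q k x)

variable {X : Type u} {Y : Type u'} [MetricSpace X] [MetricSpace Y]
  {P : Presentation.{u, v} X} {Q : Presentation.{u', v'} Y} {π : C(X, Y)}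

section Indicator

variable {A : Type*} [NormedCommRing A]

/-- Pointwise: the indicator of a fibre of `Y` at `π x` is the sum over the fibres of `X` lying
over it. -/
theorem indicator_fiber_comp (h : Hom P Q π) (k : ℕ) (b : Q.F k) (x : X) :
    (Q.fiber k b).indicator (1 : Y → A) (π x) =
      ∑ a ∈ univ.filter (fun a : P.F k => h.level k a = b), (P.fiber k a).indicator (1 : X → A) x := by
  by_cases hb : Q.q k (π x) = b
  · rw [Set.indicator_of_mem (show π x ∈ Q.fiber k b from hb),
      Finset.sum_eq_single_of_mem (P.q k x)
        (Finset.mem_filter.2 ⟨Finset.mem_univ _, (h.level_q k x).symm.trans hb⟩)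
        (fun a _ ha => P.indicator_fiber_of_ne (Ne.symm ha) _),
      Set.indicator_of_mem (P.mem_fiber_self k x)]
    rfl
  · rw [Set.indicator_of_notMem (show π x ∉ Q.fiber k b from hb)]
    refine (Finset.sum_eq_zero fun a ha => ?_).symm
    refine P.indicator_fiber_of_ne (fun hxa => hb ?_) _
    rw [h.level_q, hxa]
    exact (Finset.mem_filter.1 ha).2

/-- The indicator of a fibre of `Y` pulled back along `π` is the sum of the indicators of the
fibres of `X` over it. -/
theorem indicatorCM_fiber_comp (h : Hom P Q π) (k : ℕ) (b : Q.F k) :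
    (indicatorCM (Q.fiber k b) : C(Y, A)).comp π =
      ∑ a ∈ univ.filter (fun a : P.F k => h.level k a = b), indicatorCM (P.fiber k a) := by
  ext x
  simp only [ContinuousMap.comp_apply, ContinuousMap.coe_sum, Finset.sum_apply,
    indicatorCM_apply (Q.isClopen_fiber _ _), indicatorCM_apply (P.isClopen_fiber _ _)]
  exact indicator_fiber_comp h k b x

/-- THE PUSH-FORWARD ON COORDINATES: `coord (π_* m) k b = Σ_{a : level k a = b} coord m k a` —
the printed map `W[Γ⁻/p^kΓ⁻] → W[Γ_𝔭/p^kΓ_𝔭]`, `Σ_a v_a [a] ↦ Σ_b (Σ_{π(a) = b} v_a) [b]`. -/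
theorem coord_pushforward (h : Hom P Q π) (m : C(X, A) →ₗ[A] A) (k : ℕ) (b : Q.F k) :
    Q.coord (pushforward π m) k b =
      ∑ a ∈ univ.filter (fun a : P.F k => h.level k a = b), P.coord m k a := by
  simp only [Presentation.coord_apply]
  rw [pushforward_apply, indicatorCM_fiber_comp h, map_sum]

/-- The push-forward along `π` of a measure bounded by `C` is bounded by `C`, and its coordinates
are the fibre sums of the coordinates of `m` (the distribution of `π_* m`). -/
theorem toDistribution_pushforward_val [CompactSpace X] [CompactSpace Y] [NormOneClass A]
    (h : Hom P Q π) (m : C(X, A) →ₗ[A] A) {C : ℝ} (hC : 0 ≤ C)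
    (hm : ∀ φ : C(X, A), ‖m φ‖ ≤ C * ‖φ‖) :
    (Q.toDistribution (pushforward π m) hC
      (Summit.Ventures.HodgeRepro2.T5PushforwardMeasure.norm_pushforward_le π m hC hm)).val =
      fun k b => ∑ a ∈ univ.filter (fun a : P.F k => h.level k a = b), P.coord m k a := by
  ext k b
  rw [Presentation.toDistribution_val, coord_pushforward h]

end Indicator

section Padic

variable (p : ℕ) [Fact (Nat.Prime p)] (ι : Type*) [Fintype ι] [DecidableEq ι]

/-- The coordinate projection `ℤ_p^ι → ℤ_p`, `x ↦ x i₀`, as a continuous map. -/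
def proj (i₀ : ι) : C(ι → ℤ_[p], ℤ_[p]) := ⟨fun x => x i₀, continuous_apply i₀⟩

/-- The coordinate projection is a morphism of presentations, with level maps `a ↦ a i₀`. -/
def projHom (i₀ : ι) : Hom (padicProductPresentation p ι) (padicPresentation p) (proj p ι i₀) where
  level _ a := a i₀
  level_q _ _ := rfl

/-- `ℤ_p`-linear combination of the coordinates, `x ↦ Σ_i c_i x_i`, as a continuous map
(every `ℤ_p`-linear map `ℤ_p^ι → ℤ_p` is of this form — the projection `Γ⁻ → Γ_𝔭` in the
coordinates of `Γ⁻ ≅ ℤ_p^δ`). -/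
noncomputable def linear (c : ι → ℤ_[p]) : C(ι → ℤ_[p], ℤ_[p]) :=
  ⟨fun x => ∑ i, c i * x i, continuous_finsetSum _ fun i _ => (continuous_const.mul (continuous_apply i))⟩

omit [DecidableEq ι] in
/-- `linear p ι c x = Σ_i c_i x_i`. -/
theorem linear_apply (c : ι → ℤ_[p]) (x : ι → ℤ_[p]) : linear p ι c x = ∑ i, c i * x i := rfl

/-- A linear combination of the coordinates is a morphism of presentations, with level maps the
same linear combination of the reductions mod `p^k`. -/
noncomputable def linearHom (c : ι → ℤ_[p]) :
    Hom (padicProductPresentation p ι) (padicPresentation p) (linear p ι c) where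
  level k a := (∑ i, PadicInt.toZModPow k (c i) * a i : ZMod (p ^ k))
  level_q k x := by
    show PadicInt.toZModPow k (∑ i, c i * x i) = ∑ i, PadicInt.toZModPow k (c i) * PadicInt.toZModPow k (x i)
    rw [map_sum]
    exact Finset.sum_congr rfl fun i _ => map_mul _ _ _

variable {A : Type*} [NormedCommRing A]

/-- THE PRINTED FORMULA for `Γ⁻ ≅ ℤ_p^ι → Γ_𝔭 ≅ ℤ_p`, `x ↦ Σ_i c_i x_i`: the value of the
push-forward measure on the coset `b + p^kℤ_p` is the sum of the values of `m` on the cosets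
`a + p^kℤ_p^ι` with `Σ_i c_i a_i ≡ b (mod p^k)`. -/
theorem coord_pushforward_linear (c : ι → ℤ_[p]) (m : C(ι → ℤ_[p], A) →ₗ[A] A) (k : ℕ)
    (b : ZMod (p ^ k)) :
    (padicPresentation p).coord (pushforward (linear p ι c) m) k b =
      ∑ a ∈ univ.filter (fun a : ι → ZMod (p ^ k) => ∑ i, PadicInt.toZModPow k (c i) * a i = b),
        (padicProductPresentation p ι).coord m k a :=
  coord_pushforward (linearHom p ι c) m k b

/-- The same for the coordinate projection `x ↦ x i₀`. -/
theorem coord_pushforward_proj (i₀ : ι) (m : C(ι → ℤ_[p], A) →ₗ[A] A) (k : ℕ) (b : ZMod (p ^ k)) :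
    (padicPresentation p).coord (pushforward (proj p ι i₀) m) k b =
      ∑ a ∈ univ.filter (fun a : ι → ZMod (p ^ k) => a i₀ = b),
        (padicProductPresentation p ι).coord m k a :=
  coord_pushforward (projHom p ι i₀) m k b

end Padic

/-! ## The branch measures of `ModelData` in the printed coordinates -/
open Summit.Ventures.HodgeRepro2.T5MeasureSupOnClopens (indicatorCM twist_apply)
open Summit.Ventures.HodgeRepro2.T5ProfiniteDistribution
open Summit.Ventures.HodgeRepro2.T5ProfiniteDistributionPadic
open Summit.Ventures.HodgeRepro2.T5PropGBranchModel
open Finset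

variable {p : ℕ} [Fact (Nat.Prime p)] {ι : Type*} [Fintype ι] [DecidableEq ι]
variable {A : Type*} [NormedCommRing A] [IsDomain A] [IsDiscreteValuationRing A]
variable {R' : Type*} [NormedCommRing R'] [Algebra A R'] {K : Type*} [Field K] {J : Type*}

/-- The Hsieh measure of a model datum on `Γ⁻ = ℤ_p^ι` is determined by its values on the cosets
of the `p^kΓ⁻`: two model data with the same coordinates of `M` have the same `M`. -/
theorem coord_M_eq_of_coord_eq (D D' : ModelData p (ι → ℤ_[p]) A R' K J)
    (h : (padicProductPresentation p ι).coord D.M = (padicProductPresentation p ι).coord D'.M) :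
    D.M = D'.M :=
  (padicProductPresentation p ι).eq_of_coord_eq D.M D'.M (C := max D.C D'.C)
    (le_max_of_le_left D.hC)
    (fun φ => (D.hM φ).trans (mul_le_mul_of_nonneg_right (le_max_left _ _) (norm_nonneg φ)))
    (fun φ => (D'.hM φ).trans (mul_le_mul_of_nonneg_right (le_max_right _ _) (norm_nonneg φ)))
    (fun k a => by rw [h])

/-- THE TWIST ON THE COORDINATES: `coord (ν̃·M) k a = M(ν̃ · 1_{a + p^kΓ⁻})`. -/
theorem coord_Mlam (D : ModelData p (ι → ℤ_[p]) A R' K J) (k : ℕ) (a : ι → ZMod (p ^ k)) :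
    (padicProductPresentation p ι).coord D.Mlam k a =
      D.M (D.ν * indicatorCM ((padicProductPresentation p ι).fiber k a)) := by
  rw [Presentation.coord_apply, ModelData.Mlam, twist_apply]

/-- THE 𝔭-LINE MEASURE IN THE PRINTED COORDINATES: for `π(x) = Σ_i c_i x_i`, the value of
`L⁻_{Σ,λ⁻¹,𝔭} = π_*(L⁻_{Σ,λ⁻¹})` on `b + p^kℤ_p` is the sum of the values of `L⁻_{Σ,λ⁻¹}` on the
cosets `a + p^kΓ⁻` with `Σ_i c_i a_i ≡ b (mod p^k)` — the image under the map
`W[[Γ⁻]] → W[[Γ_𝔭]]` induced by `Γ⁻ → Γ_𝔭`, level by level. -/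
theorem coord_Mp_of_linear (D : ModelData p (ι → ℤ_[p]) A R' K J) (c : ι → ℤ_[p])
    (hπ : D.π = linear p ι c) (k : ℕ) (b : ZMod (p ^ k)) :
    (padicPresentation p).coord D.Mp k b =
      ∑ a ∈ univ.filter (fun a : ι → ZMod (p ^ k) => ∑ i, PadicInt.toZModPow k (c i) * a i = b),
        (padicProductPresentation p ι).coord D.Mlam k a := by
  rw [ModelData.Mp, hπ]
  exact coord_pushforward_linear p ι c D.Mlam k b

/-- The same for a coordinate projection `π(x) = x i₀`. -/
theorem coord_Mp_of_proj (D : ModelData p (ι → ℤ_[p]) A R' K J) (i₀ : ι)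
    (hπ : D.π = proj p ι i₀) (k : ℕ) (b : ZMod (p ^ k)) :
    (padicPresentation p).coord D.Mp k b =
      ∑ a ∈ univ.filter (fun a : ι → ZMod (p ^ k) => a i₀ = b),
        (padicProductPresentation p ι).coord D.Mlam k a := by
  rw [ModelData.Mp, hπ]
  exact coord_pushforward_proj p ι i₀ D.Mlam k b

/-- The 𝔭-line measure is determined by the Hsieh measure's values on the cosets of the `p^kΓ⁻`
(through the twist and the level-wise sums): two model data with the same `ν̃`, the same `π` and
the same coordinates of `M` have the same `Mp`. -/
theorem Mp_eq_of_coord_eq (D D' : ModelData p (ι → ℤ_[p]) A R' K J) (hν : D.ν = D'.ν)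
    (hπ : D.π = D'.π)
    (h : (padicProductPresentation p ι).coord D.M = (padicProductPresentation p ι).coord D'.M) :
    D.Mp = D'.Mp := by
  have hM := coord_M_eq_of_coord_eq D D' h
  simp only [ModelData.Mp, ModelData.Mlam, hM, hν, hπ]

end Summit.Ventures.HodgeRepro2.T5ProfiniteDistributionPushforward
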